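import Summits.QuantumFields.BalabanUV.Beta.RemainderExplicitHistoryDiagonalWindow

/-!
# RemainderExplicitHistoryDiagonalOneStepMonotone — ROAD P3, ORDER-0 PROFILE FAMILY: EXACT MONOTONICITY OF THE MATCHED DISCREPANCY IN THE
# POSITION FOR ONE-STEP MEMORY — for two infrared-pinned runs (A: `K` steps, B: `K + n` steps) of `β_{k+1} = b + ρ(1)·min(g_k, |g_k − g_{k−1}|)`
# (profile supported on the age `1`, ANY `ρ(1) ≥ 0`, NO smallness) the matched discrepancy `d_j = 1∕(g^B_{j+n})² − 1∕(g^A_j)²` AND the coupling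
# gap `e_j = g^A_j − g^B_{j+n}` are NON-INCREASING in the position `j` (census item (i′) of generations 50–52, settled for one-step memory by a
# backward induction from the pin: `d_j − d_{j+1} = ρ(1)·(e_{j−1} − e_j)` and the conversion `e ↔ d` is strictly monotone at non-decreasing
# couplings); for general shift `n` the question reduces to `n = 1` by telescoping (any profile); family forms: along ONE run the continuum
# correction `astar g m − 1∕(g^K_{K−m})²` is non-decreasing in the infrared distance `m`
# (station S-d4p3-g53-1 «exact monotonicity in the position», first file)

Cell `pub-balaban`, β-function sub-cell, BINDER row D4 «RemainderConst leaves for Bałaban's split» (`HOME/BINDER-OWNERS.md`; owner lineage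
`b2b-balaban-beta-an4`; this file by co-owner #3 lineage `b2b-balaban-beta-d4-p3`, road P3 «the reduction road», generation 53, station
S-d4p3-g53-1, first file; imports generation 49's `RemainderExplicitHistoryDiagonalWindow` only (hence `…TwoRun`, `…Weights`, `…Monotone`)),
β-FLOW TEAM duty (1); FREEZE (0) honoured (def-free module in road P3's own `RemainderExplicit*` series; no leaf, no interface, no Literature
file).  SOURCE OF THE SHAPES ONLY: [Balaban1987RG1] (0.20) p. 256, (0.31) and Thm 2 p. 259, §5 p. 298.  [folklore] real analysis about ONE
explicit toy family (ours), road P3's ORDER-0 PROFILE FAMILY `β_{k+1} = b + Σ_{i≤k} ρ(k−i)·min(g_k, |g_k − g_i|)` (generation 44).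
HONEST FRAMING: *"Discharging BetaPertH makes Bałaban's UV stability UNCONDITIONAL — a real constructive-QFT result; it is NOT the continuum
limit and NOT the Clay problem."*  THIS FILE DISCHARGES NOTHING OF THE KIND; nothing of Bałaban's (1.22) is asserted or constructed; row D4
class UNCHANGED (critical-path width 0; instance 0∕1; D4 DISCHARGE NO DATE); NOT B12 Thm 2, NOT BetaPertH, NOT continuum, NOT Clay.  HONEST
DEPENDENCY: continuum YM on T⁴ ⇐ BetaPertH ∧ nine spine estimates (0/9 proved); BetaPertH ⇐ (D1) ∧ (D4) ∧ CAP+tail; G-an2-4 gates asym, D1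
and NE2/3/4.  ABSOLUTE RULE: nothing is cited as a fact.  All letters NOT-IN-PRINT; `BetaFlowAsPrinted S` records a Markov β_n only.

THE QUESTION (census OPEN (i′) of generations 50–52).  The matched discrepancy `d_j ≥ 0` of two pinned runs (generation 47's maximum
principle) vanishes at the pin; generation 50 proved `max_{[j₀,K]} d ≤ d_{j₀}∕(1 − Wγ∕b)` and found two-age profiles with `d_{j+1} > d_j`
(numerics), while every NON-INCREASING profile tested obeyed `d_{j+1} ≤ d_j` («mechanism OPEN; e is not monotone»).  By
`…Window.disc_step_window`, `d_j − d_{j+1} = E_j + Σ_{i≤j} ρ(j−i)(e_i − e_j)`, `E_j ≥ 0` B's extra-age source.  THIS FILE settles one-step memory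
`ρ = ρ(1)·𝟙_{a=1}` completely (§2: `E_j = 0` for `j ≥ 1`, the identity is `d_j − d_{j+1} = ρ(1)(e_{j−1} − e_j)`, the pin gives `d_{K−1} ≥ d_K = 0`,
and `e_{j−1} ≥ e_j ⇒ d_{j−1} ≥ d_j` because `e = c − (c⁻² + d)^{−1∕2}` is strictly increasing in `d` and non-decreasing in the larger coupling
`c` — ONE nonnegative decrement propagates from the pin to the ultraviolet end, no smallness), records the reduction of a general shift `n` to
`n = 1` (§3, any profile) and the family read-out (§4).  The general non-increasing profile stays OPEN (seat numerics at 60 digits, ≈ 1 800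
cases without violation, `HOME/b2b-balaban-beta-d4-p3/g53/numerics/`; the decrement recursion `δ_j = Σ_i (Σ_{a≥i} ρ(a)c_{j−a})δ_{j−i} + E_j −
(Σ_a ρ(a)(c_j − c_{j−a}))d_j`, `c_i = e_i∕d_i` non-decreasing, is the located obstruction: a forward induction is blind to the pin in the
source-free stretch, a backward one to `E` inside the memory).

WHAT IS PROVED ([folklore]; 0 sorry; 0 `def`).  §1 `gap_lt_gap_of_disc_lt` (`0 < a, a′`, `0 < c ≤ c′`, `0 ≤ 1∕a² − 1∕c² < 1∕a′² − 1∕c′²` ⇒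
`c − a < c′ − a′`), `disc_le_disc_of_gap_le`.  §2 ONE-STEP MEMORY, two pinned runs: `extra_nonneg` (any profile), `disc_step_oneStep` (`1 ≤ j < K`
⇒ `d_j − d_{j+1} = ρ(1)(e_{j−1} − e_j)`), `disc_step_zero` (`d_0 − d_1 = E_0`), **`disc_succ_le_disc_oneStep`** (`d_{j+1} ≤ d_j`, every `j < K`),
`disc_eq_zero_markov`, **`gap_succ_le_gap_oneStep`** (`e_{j+1} ≤ e_j`, every `j < K`).  §3 ANY PROFILE: `shiftDisc_eq_sum`, **`shift_mono_of_succ_mono`**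
(shift `1` at every run length ⇒ every shift).  §4 PINNED FAMILY, one-step memory: **`invSq_shift_mono_position`** (`invSq g m (j+1+n) − invSq g m
(j+1) ≤ invSq g (m+1) (j+n) − invSq g (m+1) j`), **`astar_sub_invSq_mono_position`** (`astar g m − invSq g m (j+1) ≤ astar g (m+1) − invSq g (m+1) j`:
along ONE run the continuum correction grows towards the ultraviolet end), `astar_sub_invSq_mono_position_le` (`… (j+t) ≤ … (m+t) … j`).
-/

noncomputable section

open Finset Filter Topology

namespace Summit.QuantumFields.BalabanUV.Beta.RemainderExplicitHistoryDiagonalOneStepMonotone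

open Literature.MathematicalPhysics.QuantumFieldTheory.Balaban1983to89
open Literature.MathematicalPhysics.QuantumFieldTheory.Balaban1983to89.FlowStep
open Literature.MathematicalPhysics.QuantumFieldTheory.Balaban1983to89.T4CouplingMatching
open Literature.MathematicalPhysics.QuantumFieldTheory.Balaban1983to89.T4ContinuumCoupling
open Summit.QuantumFields.BalabanUV.Beta.RemainderExplicitHistoryDiagonalMonotone
open Summit.QuantumFields.BalabanUV.Beta.RemainderExplicitHistoryDiagonalWeights
open Summit.QuantumFields.BalabanUV.Beta.RemainderExplicitHistoryDiagonalTwoRun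
open Summit.QuantumFields.BalabanUV.Beta.RemainderExplicitHistoryDiagonalWindow

variable {β : HBeta} {b γ W : ℝ} {ρ : ℕ → ℝ}

/-! ## §1 The conversion between the coupling gap and the inverse-square discrepancy is strictly monotone -/

/-- **THE CONVERSION IS STRICTLY MONOTONE.**  For couplings `0 < a`, `0 < a′`, `0 < c ≤ c′` with `0 ≤ 1∕a² − 1∕c² < 1∕a′² − 1∕c′²`:
`c − a < c′ − a′` — the gap `e = c − (c⁻² + d)^{−1∕2}` is strictly increasing in the discrepancy `d` and non-decreasing in the larger coupling `c`
(generation 47's `coupling_gap_monotone` through the intermediate coupling `a″ = (c′⁻² + d)^{−1∕2}`). [folklore] -/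
theorem gap_lt_gap_of_disc_lt {a a' c c' : ℝ} (ha : 0 < a) (ha' : 0 < a') (hc : 0 < c) (hcc : c ≤ c')
    (hd0 : 0 ≤ 1 / a ^ 2 - 1 / c ^ 2) (hd : 1 / a ^ 2 - 1 / c ^ 2 < 1 / a' ^ 2 - 1 / c' ^ 2) : c - a < c' - a' := by
  have hc' : 0 < c' := lt_of_lt_of_le hc hcc
  set d : ℝ := 1 / a ^ 2 - 1 / c ^ 2 with hd_def
  -- the intermediate coupling `a″` with `1∕a″² = 1∕c′² + d`
  have hq : 0 < 1 / c' ^ 2 + d := by positivity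
  set a'' : ℝ := 1 / Real.sqrt (1 / c' ^ 2 + d) with ha''_def
  have hsq : 0 < Real.sqrt (1 / c' ^ 2 + d) := Real.sqrt_pos.mpr hq
  have ha'' : 0 < a'' := by rw [ha''_def]; positivity
  have ha''sq : 1 / a'' ^ 2 = 1 / c' ^ 2 + d := by
    rw [ha''_def, one_div_pow, Real.sq_sqrt hq.le, one_div_one_div]
  -- `a ≤ a″` since `1∕a″² = 1∕c′² + d ≤ 1∕c² + d = 1∕a²`
  have hcc2 : 1 / c' ^ 2 ≤ 1 / c ^ 2 := one_div_le_one_div_of_le (pow_pos hc 2) (pow_le_pow_left₀ hc.le hcc 2)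
  have haa'' : a ≤ a'' := by
    refine le_of_one_div_sq_le ha'' ha ?_
    rw [ha''sq, hd_def]; linarith
  -- step 1 (non-decreasing in the larger coupling): `c − a ≤ c′ − a″`
  have h1 : c - a ≤ c' - a'' :=
    coupling_gap_monotone ha hc haa'' hcc (by rw [ha''sq]; linarith) (by rw [ha''sq]; linarith)
  -- step 2 (strictly increasing in the discrepancy): `a′ < a″`
  have h2 : a' < a'' := by
    have hlt : 1 / a'' ^ 2 < 1 / a' ^ 2 := by rw [ha''sq]; linarith
    have h3 : a' ^ 2 < a'' ^ 2 := (one_div_lt_one_div (pow_pos ha'' 2) (pow_pos ha' 2)).mp hlt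
    nlinarith [ha', ha'']
  linarith

/-- CONTRAPOSITIVE FORM: `0 < a ≤ c`, `0 < a′`, `c ≤ c′`, `c′ − a′ ≤ c − a` ⇒ `1∕a′² − 1∕c′² ≤ 1∕a² − 1∕c²`. [folklore] -/
theorem disc_le_disc_of_gap_le {a a' c c' : ℝ} (ha : 0 < a) (ha' : 0 < a') (hc : 0 < c) (hcc : c ≤ c') (hac : a ≤ c)
    (hgap : c' - a' ≤ c - a) : 1 / a' ^ 2 - 1 / c' ^ 2 ≤ 1 / a ^ 2 - 1 / c ^ 2 := by
  by_contra h
  rw [not_le] at h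
  have hd0 : 0 ≤ 1 / a ^ 2 - 1 / c ^ 2 := by
    have := one_div_le_one_div_of_le (pow_pos ha 2) (pow_le_pow_left₀ ha.le hac 2)
    linarith
  linarith [gap_lt_gap_of_disc_lt ha ha' hc hcc hd0 h]

/-! ## §2 Two pinned runs with one-step memory: exact monotonicity in the position -/

/-- B's EXTRA-AGE SOURCE IS NONNEGATIVE (any profile `ρ ≥ 0`; runs increase): `0 ≤ Σ_{i<n} ρ(j+n−i)(g^B_{j+n} − g^B_i)`. [folklore] -/
theorem extra_nonneg
    (hβ : ∀ (k : ℕ) (p : Fin (k + 1) → ℝ),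
      β k p = b + ∑ i : Fin (k + 1), ρ (k - i) * min (p (Fin.last k)) (|p (Fin.last k) - p i|))
    (hb : 0 < b) (hρ0 : ∀ a, 0 ≤ ρ a) {K n : ℕ} {gB : ℕ → ℝ} (hB : RGEqH (K + n) β gB) (hBpos : ∀ k, k ≤ K + n → 0 < gB k)
    {j : ℕ} (hj : j ≤ K) : 0 ≤ ∑ i ∈ range n, ρ (j + n - i) * (gB (j + n) - gB i) := by
  refine Finset.sum_nonneg fun i hi => mul_nonneg (hρ0 _) ?_
  have hi' : i < n := Finset.mem_range.mp hi
  linarith [run_mono_orderZero hβ hb hρ0 hB hBpos (show i ≤ j + n by omega) (by omega)]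

/-- **THE STEP IDENTITY FOR ONE-STEP MEMORY** (`ρ(a) = 0` for `a ≥ 2`; A: `K` steps, B: `K + n` steps, positive couplings; `1 ≤ j < K`):
`d_j − d_{j+1} = ρ(1)·(e_{j−1} − e_j)` — at `j ≥ 1` B has no extra age of positive weight and the only weighted common age is `1`. [cite: Balaban1987RG1, (0.20) p.256] -/
theorem disc_step_oneStep
    (hβ : ∀ (k : ℕ) (p : Fin (k + 1) → ℝ),
      β k p = b + ∑ i : Fin (k + 1), ρ (k - i) * min (p (Fin.last k)) (|p (Fin.last k) - p i|))
    (hb : 0 < b) (hρ0 : ∀ a, 0 ≤ ρ a) (hρ1 : ∀ a, 2 ≤ a → ρ a = 0) {K n : ℕ} {gA gB : ℕ → ℝ} (hA : RGEqH K β gA)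
    (hB : RGEqH (K + n) β gB) (hApos : ∀ k, k ≤ K → 0 < gA k) (hBpos : ∀ k, k ≤ K + n → 0 < gB k) {j : ℕ} (hj1 : 1 ≤ j)
    (hj : j < K) :
    (1 / (gB (j + n)) ^ 2 - 1 / (gA j) ^ 2) - (1 / (gB (j + 1 + n)) ^ 2 - 1 / (gA (j + 1)) ^ 2)
      = ρ 1 * ((gA (j - 1) - gB (j - 1 + n)) - (gA j - gB (j + n))) := by
  rw [disc_step_window hβ hb hρ0 hA hB hApos hBpos hj]
  -- the extra ages `j + n − i ≥ j + 1 ≥ 2` carry no weight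
  have hE : ∑ i ∈ range n, ρ (j + n - i) * (gB (j + n) - gB i) = 0 := by
    refine Finset.sum_eq_zero fun i hi => ?_
    have hi' : i < n := Finset.mem_range.mp hi
    rw [hρ1 (j + n - i) (by omega), zero_mul]
  -- among the common ages only `i = j − 1` (age `1`) survives; `i = j` (age `0`) has the factor `e_j − e_j = 0`
  have hF : ∑ i ∈ range (j + 1), ρ (j - i) * ((gA i - gB (i + n)) - (gA j - gB (j + n)))
      = ρ 1 * ((gA (j - 1) - gB (j - 1 + n)) - (gA j - gB (j + n))) := by
    rw [Finset.sum_eq_single (j - 1)]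
    · rw [show j - (j - 1) = 1 by omega]
    · intro i hi hne
      have hi' : i ≤ j := Nat.lt_succ_iff.mp (Finset.mem_range.mp hi)
      by_cases hij : i = j
      · subst hij; ring
      · rw [hρ1 (j - i) (by omega), zero_mul]
    · intro h; exact absurd (Finset.mem_range.mpr (by omega : j - 1 < j + 1)) h
  rw [hE, hF, zero_add]

/-- THE FIRST STEP: at `j = 0` run A has no history at all, so `d_0 − d_1 = E_0` (any profile; `0 < K`). [cite: Balaban1987RG1, (0.20) p.256] -/
theorem disc_step_zero
    (hβ : ∀ (k : ℕ) (p : Fin (k + 1) → ℝ),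
      β k p = b + ∑ i : Fin (k + 1), ρ (k - i) * min (p (Fin.last k)) (|p (Fin.last k) - p i|))
    (hb : 0 < b) (hρ0 : ∀ a, 0 ≤ ρ a) {K n : ℕ} {gA gB : ℕ → ℝ} (hA : RGEqH K β gA) (hB : RGEqH (K + n) β gB)
    (hApos : ∀ k, k ≤ K → 0 < gA k) (hBpos : ∀ k, k ≤ K + n → 0 < gB k) (hK : 0 < K) :
    (1 / (gB (0 + n)) ^ 2 - 1 / (gA 0) ^ 2) - (1 / (gB (0 + 1 + n)) ^ 2 - 1 / (gA (0 + 1)) ^ 2)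
      = ∑ i ∈ range n, ρ (0 + n - i) * (gB (0 + n) - gB i) := by
  rw [disc_step_window hβ hb hρ0 hA hB hApos hBpos hK, Finset.sum_range_one]
  simp

/-- **EXACT MONOTONICITY IN THE POSITION, ONE-STEP MEMORY.**  Road P3's order-0 profile family with a profile supported on the age `1`
(`ρ(a) = 0` for `a ≥ 2`, ANY `ρ(1) ≥ 0`, `b > 0`); two runs — A: `K` steps, B: `K + n` steps, positive couplings — pinned `g^A_K = g^B_{K+n}`.  THEN
for every `j < K`: `1∕(g^B_{j+1+n})² − 1∕(g^A_{j+1})² ≤ 1∕(g^B_{j+n})² − 1∕(g^A_j)²`.  Backward induction from the pin (`d_{K−1} ≥ d_K = 0`): if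
`d_j − d_{j+1} = ρ(1)(e_{j−1} − e_j) ≥ 0` with `ρ(1) > 0` then `e_{j−1} ≥ e_j`, hence `d_{j−1} ≥ d_j` by `disc_le_disc_of_gap_le`; NO smallness.
[cite: Balaban1987RG1, (0.20) p.256 and Thm 2 p.259] -/
theorem disc_succ_le_disc_oneStep
    (hβ : ∀ (k : ℕ) (p : Fin (k + 1) → ℝ),
      β k p = b + ∑ i : Fin (k + 1), ρ (k - i) * min (p (Fin.last k)) (|p (Fin.last k) - p i|))
    (hb : 0 < b) (hρ0 : ∀ a, 0 ≤ ρ a) (hρ1 : ∀ a, 2 ≤ a → ρ a = 0) {K n : ℕ} {gA gB : ℕ → ℝ} (hA : RGEqH K β gA)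
    (hB : RGEqH (K + n) β gB) (hApos : ∀ k, k ≤ K → 0 < gA k) (hBpos : ∀ k, k ≤ K + n → 0 < gB k) (hpin : gA K = gB (K + n)) :
    ∀ j, j < K → 1 / (gB (j + 1 + n)) ^ 2 - 1 / (gA (j + 1)) ^ 2 ≤ 1 / (gB (j + n)) ^ 2 - 1 / (gA j) ^ 2 := by
  set d : ℕ → ℝ := fun j => 1 / (gB (j + n)) ^ 2 - 1 / (gA j) ^ 2 with hd
  have hdom := invSq_le_invSq_shift_run hβ hb hρ0 hA hB hApos hBpos hpin
  have hdK : d K = 0 := by simp [hd, hpin]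
  -- the claim at `j`, by induction on the distance `t = K − 1 − j` from the last step
  suffices hmain : ∀ t, t < K → d (K - 1 - t + 1) ≤ d (K - 1 - t) by
    intro j hj
    have h := hmain (K - 1 - j) (by omega)
    rw [show K - 1 - (K - 1 - j) = j by omega] at h
    simpa [hd, Nat.add_right_comm j 1 n] using h
  intro t
  induction t with
  | zero =>
    intro hK
    rw [Nat.sub_zero, show K - 1 + 1 = K by omega, hdK]
    have := hdom (K - 1) (by omega)
    simp only [hd]; linarith
  | succ t ih =>
    intro htK
    have ih' := ih (by omega)
    -- `j := K − 1 − t ≥ 1`; the target position is `j − 1 = K − 1 − (t+1)`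
    set j : ℕ := K - 1 - t with hj_def
    have hj1 : 1 ≤ j := by omega
    have hjK : j < K := by omega
    rw [show K - 1 - (t + 1) = j - 1 by omega, show j - 1 + 1 = j by omega]
    -- the step identity at `j`
    have hstep := disc_step_oneStep hβ hb hρ0 hρ1 hA hB hApos hBpos hj1 hjK
    have hδj : 0 ≤ d j - d (j + 1) := by
      have : d (j + 1) ≤ d j := ih'
      linarith
    rcases (hρ0 1).eq_or_lt with hρ10 | hρ1pos
    · -- Markov-like case `ρ(1) = 0`: either `j − 1 ≥ 1` and the decrement is `0`, or `j − 1 = 0` and it is `E_0 ≥ 0`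
      by_cases hj2 : 2 ≤ j
      · have h2 := disc_step_oneStep hβ hb hρ0 hρ1 hA hB hApos hBpos (by omega : 1 ≤ j - 1) (by omega : j - 1 < K)
        rw [show j - 1 + 1 = j by omega, ← hρ10, zero_mul] at h2
        simp only [hd]; linarith
      · have hj0 : j - 1 = 0 := by omega
        have h0 := disc_step_zero hβ hb hρ0 hA hB hApos hBpos (by omega : 0 < K)
        have hE := extra_nonneg hβ hb hρ0 hB hBpos (j := 0) (by omega)
        rw [hj0, show j = 0 + 1 by omega]
        simp only [hd]
        simp only [Nat.zero_add] at h0 hE ⊢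
        rw [Nat.add_comm 1 n] at h0 ⊢
        linarith
    · -- `ρ(1) > 0`: the decrement at `j` is `ρ(1)(e_{j−1} − e_j) ≥ 0`, so `e_{j−1} ≥ e_j`, so `d_{j−1} ≥ d_j`
      have hgap : gA j - gB (j + n) ≤ gA (j - 1) - gB (j - 1 + n) := by
        have h' : 0 ≤ ρ 1 * ((gA (j - 1) - gB (j - 1 + n)) - (gA j - gB (j + n))) := by
          rw [← hstep]; simpa [hd, Nat.add_right_comm j 1 n] using hδj
        nlinarith
      have hmonoA := run_mono_orderZero hβ hb hρ0 hA hApos (show j - 1 ≤ j by omega) hjK.le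
      have hacj : gB (j - 1 + n) ≤ gA (j - 1) :=
        le_of_one_div_sq_le (hApos _ (by omega)) (hBpos _ (by omega)) (hdom (j - 1) (by omega))
      have h := disc_le_disc_of_gap_le (hBpos (j - 1 + n) (by omega)) (hBpos (j + n) (by omega)) (hApos (j - 1) (by omega))
        hmonoA hacj hgap
      simpa [hd] using h

/-- THE MARKOV CASE: if the profile vanishes at every positive age then two pinned runs AGREE at every matched position, `1∕(g^B_{j+n})² = 1∕(g^A_j)²`
for `j ≤ K` (every decrement `d_j − d_{j+1}` vanishes and `d_K = 0`). [folklore] -/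
theorem disc_eq_zero_markov
    (hβ : ∀ (k : ℕ) (p : Fin (k + 1) → ℝ),
      β k p = b + ∑ i : Fin (k + 1), ρ (k - i) * min (p (Fin.last k)) (|p (Fin.last k) - p i|))
    (hb : 0 < b) (hρ0 : ∀ a, 0 ≤ ρ a) (hρM : ∀ a, 1 ≤ a → ρ a = 0) {K n : ℕ} {gA gB : ℕ → ℝ} (hA : RGEqH K β gA)
    (hB : RGEqH (K + n) β gB) (hApos : ∀ k, k ≤ K → 0 < gA k) (hBpos : ∀ k, k ≤ K + n → 0 < gB k) (hpin : gA K = gB (K + n)) :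
    ∀ j, j ≤ K → 1 / (gB (j + n)) ^ 2 - 1 / (gA j) ^ 2 = 0 := by
  set d : ℕ → ℝ := fun j => 1 / (gB (j + n)) ^ 2 - 1 / (gA j) ^ 2 with hd
  have hdK : d K = 0 := by simp [hd, hpin]
  -- every decrement vanishes
  have hδ : ∀ j, j < K → d j - d (j + 1) = 0 := by
    intro j hj
    have h := disc_step_window hβ hb hρ0 hA hB hApos hBpos hj
    have hE : ∑ i ∈ range n, ρ (j + n - i) * (gB (j + n) - gB i) = 0 := by
      refine Finset.sum_eq_zero fun i hi => ?_
      have hi' : i < n := Finset.mem_range.mp hi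
      rw [hρM (j + n - i) (by omega), zero_mul]
    have hF : ∑ i ∈ range (j + 1), ρ (j - i) * ((gA i - gB (i + n)) - (gA j - gB (j + n))) = 0 := by
      refine Finset.sum_eq_zero fun i hi => ?_
      have hi' : i ≤ j := Nat.lt_succ_iff.mp (Finset.mem_range.mp hi)
      by_cases hij : i = j
      · subst hij; ring
      · rw [hρM (j - i) (by omega), zero_mul]
    rw [hE, hF, add_zero] at h
    simpa [hd, Nat.add_right_comm j 1 n] using h
  suffices hmain : ∀ t, t ≤ K → d (K - t) = 0 by
    intro j hj
    have := hmain (K - j) (by omega)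
    rwa [show K - (K - j) = j by omega] at this
  intro t
  induction t with
  | zero => intro _; simpa using hdK
  | succ t ih =>
    intro ht
    have h1 := ih (by omega)
    have h2 := hδ (K - (t + 1)) (by omega)
    rw [show K - (t + 1) + 1 = K - t by omega, h1] at h2
    linarith

/-- **THE COUPLING GAP IS NON-INCREASING TOO, ONE-STEP MEMORY.**  Same runs: for every `j < K`, `g^A_{j+1} − g^B_{j+1+n} ≤ g^A_j − g^B_{j+n}`
(`ρ(1) > 0`: the decrement at `j + 1` is `ρ(1)(e_j − e_{j+1}) ≥ 0`, and `e_K = 0 ≤ e_{K−1}`; `ρ(1) = 0`: `disc_eq_zero_markov`).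
[cite: Balaban1987RG1, (0.20) p.256 and Thm 2 p.259] -/
theorem gap_succ_le_gap_oneStep
    (hβ : ∀ (k : ℕ) (p : Fin (k + 1) → ℝ),
      β k p = b + ∑ i : Fin (k + 1), ρ (k - i) * min (p (Fin.last k)) (|p (Fin.last k) - p i|))
    (hb : 0 < b) (hρ0 : ∀ a, 0 ≤ ρ a) (hρ1 : ∀ a, 2 ≤ a → ρ a = 0) {K n : ℕ} {gA gB : ℕ → ℝ} (hA : RGEqH K β gA)
    (hB : RGEqH (K + n) β gB) (hApos : ∀ k, k ≤ K → 0 < gA k) (hBpos : ∀ k, k ≤ K + n → 0 < gB k) (hpin : gA K = gB (K + n)) :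
    ∀ j, j < K → gA (j + 1) - gB (j + 1 + n) ≤ gA j - gB (j + n) := by
  intro j hj
  have hdom := invSq_le_invSq_shift_run hβ hb hρ0 hA hB hApos hBpos hpin
  rcases (hρ0 1).eq_or_lt with hρ10 | hρ1pos
  · -- Markov: both gaps vanish
    have hM : ∀ a, 1 ≤ a → ρ a = 0 := fun a ha => by
      rcases Nat.lt_or_ge a 2 with h | h
      · have : a = 1 := by omega
        rw [this, ← hρ10]
      · exact hρ1 a h
    have hz := disc_eq_zero_markov hβ hb hρ0 hM hA hB hApos hBpos hpin
    have e1 : gB (j + n) = gA j := by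
      have h := hz j hj.le
      have h1 : 1 / (gB (j + n)) ^ 2 = 1 / (gA j) ^ 2 := by linarith
      have hle := le_of_one_div_sq_le (hApos j hj.le) (hBpos (j + n) (by omega)) h1.ge
      have hge := le_of_one_div_sq_le (hBpos (j + n) (by omega)) (hApos j hj.le) h1.le
      linarith
    have e2 : gB (j + 1 + n) = gA (j + 1) := by
      have h := hz (j + 1) (by omega)
      rw [Nat.add_right_comm j 1 n] at h ⊢
      have h1 : 1 / (gB (j + n + 1)) ^ 2 = 1 / (gA (j + 1)) ^ 2 := by linarith
      have hle := le_of_one_div_sq_le (hApos (j + 1) (by omega)) (hBpos (j + n + 1) (by omega)) h1.ge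
      have hge := le_of_one_div_sq_le (hBpos (j + n + 1) (by omega)) (hApos (j + 1) (by omega)) h1.le
      linarith
    rw [e1, e2]; simp
  · by_cases hjK : j + 1 < K
    · -- interior: the decrement at `j + 1` is `ρ(1)(e_j − e_{j+1}) ≥ 0`
      have hstep := disc_step_oneStep hβ hb hρ0 hρ1 hA hB hApos hBpos (by omega : 1 ≤ j + 1) hjK
      have hmono := disc_succ_le_disc_oneStep hβ hb hρ0 hρ1 hA hB hApos hBpos hpin (j + 1) hjK
      rw [show j + 1 - 1 = j by omega] at hstep
      have h' : 0 ≤ ρ 1 * ((gA j - gB (j + n)) - (gA (j + 1) - gB (j + 1 + n))) := by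
        rw [← hstep]; linarith
      nlinarith
    · -- last step: `e_K = 0 ≤ e_{K−1}`
      have hjK' : j + 1 = K := by omega
      rw [hjK', hpin, sub_self]
      linarith [le_of_one_div_sq_le (hApos j hj.le) (hBpos (j + n) (by omega)) (hdom j hj.le)]

/-! ## §3 Any profile: exact monotonicity for the shift `1` at every run length gives it for every shift -/

/-- TELESCOPING THE SHIFT: `u m (j + n) − u m j = Σ_{l<n} (u m (j + l + 1) − u m (j + l))`. [folklore] -/
theorem shiftDisc_eq_sum (u : ℕ → ℕ → ℝ) (m j n : ℕ) :
    u m (j + n) - u m j = ∑ l ∈ range n, (u m (j + l + 1) - u m (j + l)) := by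
  induction n with
  | zero => simp
  | succ n ih =>
    rw [Finset.sum_range_succ, ← ih, show j + (n + 1) = j + n + 1 by omega]
    ring

/-- **THE SHIFT `n` REDUCES TO THE SHIFT `1`** (any doubly indexed `u`, e.g. `u = invSq g` of a pinned family of ANY profile).  If for all `m, j`
`u m (j+2) − u m (j+1) ≤ u (m+1) (j+1) − u (m+1) j` (the runs of lengths `j+1+m` and `j+2+m`: the cutoff increment read at infrared distance `m`
is at most the one read one position further from the pin), THEN for all `m, j, n`: `u m (j+1+n) − u m (j+1) ≤ u (m+1) (j+n) − u (m+1) j`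
(runs of lengths `j+1+m` and `j+1+m+n`), by `shiftDisc_eq_sum` term by term. [folklore] -/
theorem shift_mono_of_succ_mono (u : ℕ → ℕ → ℝ)
    (h1 : ∀ m j, u m (j + 2) - u m (j + 1) ≤ u (m + 1) (j + 1) - u (m + 1) j) (m j n : ℕ) :
    u m (j + 1 + n) - u m (j + 1) ≤ u (m + 1) (j + n) - u (m + 1) j := by
  rw [shiftDisc_eq_sum u m (j + 1) n, shiftDisc_eq_sum u (m + 1) j n]
  refine Finset.sum_le_sum fun l _ => ?_
  have h := h1 m (j + l)
  have e1 : j + 1 + l + 1 = j + l + 2 := by omega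
  have e2 : j + 1 + l = j + l + 1 := by omega
  rw [e1, e2]
  exact h

/-! ## §4 Pinned family with one-step memory: the continuum correction grows towards the ultraviolet end of a run -/

/-- **FAMILY FORM.**  A pinned family of runs with one-step memory (`ρ(a) = 0` for `a ≥ 2`; `g K` the run with `K` steps in ]0,γ], `g K K = g_IR`):
`invSq g m (j+1+n) − invSq g m (j+1) ≤ invSq g (m+1) (j+n) − invSq g (m+1) j` for all `m, j, n` (runs of lengths `j+1+m` and `j+1+m+n`;
`disc_succ_le_disc_oneStep` BY NAME). [cite: Balaban1987RG1, (0.20) p.256 and Thm 2 p.259] -/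
theorem invSq_shift_mono_position
    (hβ : ∀ (k : ℕ) (p : Fin (k + 1) → ℝ),
      β k p = b + ∑ i : Fin (k + 1), ρ (k - i) * min (p (Fin.last k)) (|p (Fin.last k) - p i|))
    (hb : 0 < b) (hρ0 : ∀ a, 0 ≤ ρ a) (hρ1 : ∀ a, 2 ≤ a → ρ a = 0) {g : ℕ → ℕ → ℝ} {gIR : ℝ} (hrun : ∀ K, RGEqH K β (g K))
    (hbox : ∀ K i, i ≤ K → 0 < g K i ∧ g K i ≤ γ) (hpin : ∀ K, g K K = gIR) (m j n : ℕ) :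
    invSq g m (j + 1 + n) - invSq g m (j + 1) ≤ invSq g (m + 1) (j + n) - invSq g (m + 1) j := by
  have hA : RGEqH (j + 1 + m) β (g (j + 1 + m)) := hrun _
  have hB : RGEqH (j + 1 + m + n) β (g (j + 1 + m + n)) := hrun _
  have hpin' : g (j + 1 + m) (j + 1 + m) = g (j + 1 + m + n) (j + 1 + m + n) := by rw [hpin, hpin]
  have h := disc_succ_le_disc_oneStep hβ hb hρ0 hρ1 hA hB (fun k hk => (hbox _ k hk).1) (fun k hk => (hbox _ k hk).1) hpin'
    j (by omega)
  have e1 : invSq g m (j + 1 + n) = 1 / (g (j + 1 + m + n) (j + 1 + n)) ^ 2 := by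
    rw [invSq_def, show j + 1 + n + m = j + 1 + m + n by omega]
  have e2 : invSq g m (j + 1) = 1 / (g (j + 1 + m) (j + 1)) ^ 2 := by rw [invSq_def]
  have e3 : invSq g (m + 1) (j + n) = 1 / (g (j + 1 + m + n) (j + n)) ^ 2 := by
    rw [invSq_def, show j + n + (m + 1) = j + 1 + m + n by omega]
  have e4 : invSq g (m + 1) j = 1 / (g (j + 1 + m) j) ^ 2 := by
    rw [invSq_def, show j + (m + 1) = j + 1 + m by omega]
  rw [e1, e2, e3, e4]
  exact h

/-- **THE CONTINUUM CORRECTION GROWS TOWARDS THE ULTRAVIOLET END OF A RUN** (one-step memory; `γ > 0`, `Σ_{a<N} ρ(a) ≤ W` for the limits).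
Same family: `astar g m − invSq g m (j+1) ≤ astar g (m+1) − invSq g (m+1) j` for all `m, j` — along the ONE run of length `j + 1 + m` the
discrepancy from the continuum coupling at infrared distance `m` is at most the one at `m + 1` (`n → ∞` in `invSq_shift_mono_position`, by
generation 47's `continuum_monotone`). [cite: Balaban1987RG1, (0.20) p.256, (0.31) and Thm 2 p.259] -/
theorem astar_sub_invSq_mono_position
    (hβ : ∀ (k : ℕ) (p : Fin (k + 1) → ℝ),
      β k p = b + ∑ i : Fin (k + 1), ρ (k - i) * min (p (Fin.last k)) (|p (Fin.last k) - p i|))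
    (hb : 0 < b) (hγ : 0 < γ) (hρ0 : ∀ a, 0 ≤ ρ a) (hρW : ∀ n, ∑ a ∈ range n, ρ a ≤ W) (hρ1 : ∀ a, 2 ≤ a → ρ a = 0)
    {g : ℕ → ℕ → ℝ} {gIR : ℝ} (hrun : ∀ K, RGEqH K β (g K)) (hbox : ∀ K i, i ≤ K → 0 < g K i ∧ g K i ≤ γ)
    (hpin : ∀ K, g K K = gIR) (m j : ℕ) :
    astar g m - invSq g m (j + 1) ≤ astar g (m + 1) - invSq g (m + 1) j := by
  have hlim := (continuum_monotone hβ hb hγ hρ0 hρW hrun hbox hpin).1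
  -- the two sides as limits in the shift `n`
  have h1 : Tendsto (fun n => invSq g m (j + 1 + n) - invSq g m (j + 1)) atTop (𝓝 (astar g m - invSq g m (j + 1))) :=
    ((hlim m).comp (tendsto_atTop_atTop_of_monotone (fun a b hab => by omega) fun n => ⟨n, by omega⟩)).sub
      tendsto_const_nhds
  have h2 : Tendsto (fun n => invSq g (m + 1) (j + n) - invSq g (m + 1) j) atTop
      (𝓝 (astar g (m + 1) - invSq g (m + 1) j)) :=
    ((hlim (m + 1)).comp (tendsto_atTop_atTop_of_monotone (fun a b hab => by omega) fun n => ⟨n, by omega⟩)).sub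
      tendsto_const_nhds
  exact le_of_tendsto_of_tendsto' h1 h2 fun n => invSq_shift_mono_position hβ hb hρ0 hρ1 hrun hbox hpin m j n

/-- TELESCOPED IN THE INFRARED DISTANCE: for all `m, j, t`, `astar g m − invSq g m (j+t) ≤ astar g (m+t) − invSq g (m+t) j` — along the run of
length `j + t + m`, the continuum correction at infrared distance `m` is at most the one at any larger infrared distance `m + t`. [cite: Balaban1987RG1, (0.20) p.256, (0.31) and Thm 2 p.259] -/
theorem astar_sub_invSq_mono_position_le
    (hβ : ∀ (k : ℕ) (p : Fin (k + 1) → ℝ),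
      β k p = b + ∑ i : Fin (k + 1), ρ (k - i) * min (p (Fin.last k)) (|p (Fin.last k) - p i|))
    (hb : 0 < b) (hγ : 0 < γ) (hρ0 : ∀ a, 0 ≤ ρ a) (hρW : ∀ n, ∑ a ∈ range n, ρ a ≤ W) (hρ1 : ∀ a, 2 ≤ a → ρ a = 0)
    {g : ℕ → ℕ → ℝ} {gIR : ℝ} (hrun : ∀ K, RGEqH K β (g K)) (hbox : ∀ K i, i ≤ K → 0 < g K i ∧ g K i ≤ γ)
    (hpin : ∀ K, g K K = gIR) (m j t : ℕ) :
    astar g m - invSq g m (j + t) ≤ astar g (m + t) - invSq g (m + t) j := by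
  induction t generalizing m j with
  | zero => simp
  | succ t ih =>
    have h1 := astar_sub_invSq_mono_position hβ hb hγ hρ0 hρW hρ1 hrun hbox hpin m (j + t)
    have h2 := ih (m + 1) j
    rw [show j + (t + 1) = j + t + 1 by omega, show m + (t + 1) = m + 1 + t by omega]
    linarith

end Summit.QuantumFields.BalabanUV.Beta.RemainderExplicitHistoryDiagonalOneStepMonotone
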